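import Summits.CriticalPhenomena.PercolationContinuityZ3.Theorems.PercNearOneGluingNoHeavyLowerTailSahiCombTriWOrProduct
import Summits.CriticalPhenomena.PercolationContinuityZ3.Theorems.PercNearOneGluingNoHeavyLowerTailSahiCombTriWRelabel
import Summits.CriticalPhenomena.PercolationContinuityZ3.Theorems.PercNearOneGluingNoHeavyLowerTailSahiCombTriWTwoGen

/-!
# `TriWIneq` for two DISJOINT generators: `P = ↑g ∪ ↑h`, `g ∩ h = ∅` (any sizes, free coordinates allowed), all `n`, all `a`

Support file of the one-cut programme (crux `NoHeavyLowerTail`, stmt-CriticalPhenomena-4575; unit `prim-lf-1` gen 41, memo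
`FROM-prim-lf-1-gen41-SHELLS-AND-OR-PRODUCTS.md`).  First concrete corollary of the OR-product theorem (`…SahiCombTriWOrProduct`): split the ground
set into the block `g` and its complement; on the block `g` take the top family `↑univ`, on the complement the principal family `↑h`; both have
Kleitman shells (`klShell_upGen`), their OR-product is `↑g ∪ ↑h` after relabeling (`…SahiCombTriWRelabel`), so Formula A certifies it.

* `FiveUpSet.famMap_twoGen_disjoint` — under `γ ≃ {a // a ∈ g} ⊕ {a // a ∉ g}` the family `twoGen g h = {t | g ⊆ t ∨ h ⊆ t}` becomes
  `orProd (upGen univ) (upGen h')`, `h'` = `h` read in the complement block;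
* **`FiveUpSet.klShell_twoGen_disjoint`** — its shell is a Kleitman shell;
* **`FiveUpSet.triW_nonneg_twoGen_disjoint`** — `Disjoint g h`, `g, h ≠ ∅` ⟹ `0 ≤ triW (twoGen g h) F G` for EVERY index cube and all monotone
  families of up-sets.  Together with `triW_nonneg_twoGen` (gen 40: `g ∩ h ≠ ∅`, `g ∪ h = univ`, incomparable) and the principal stratum this leaves,
  among two-generator up-sets, only the intersecting case with free coordinates (a cylinder over gen 40's stratum).
Exact numerical cross-check (all pairs of up-sets, P5 oracle): `↑01∪↑23`, `↑0∪↑123` (n=4), `↑01∪↑234`, `↑0∪↑1234` (n=5), `↑01∪↑2345`, `↑012∪↑345` (n=6).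
HONEST LABEL: complete proofs, std axioms; a new unconditional stratum of `TriWIneq`; `TriWIneq` itself stays OPEN. [this work]
-/

namespace Summit.CriticalPhenomena.PercolationContinuityZ3.Theorems

namespace FiveUpSet

open Finset

variable {β γ : Type} [DecidableEq β] [Fintype β] [DecidableEq γ] [Fintype γ]

/-- The block splitting of the ground set along `g`: `γ ≃ {a // a ∈ g} ⊕ {a // a ∉ g}`. [this work] -/
def blockEquiv (g : Finset γ) : γ ≃ {a // a ∈ g} ⊕ {a // a ∉ g} := (Equiv.sumCompl fun a => a ∈ g).symm

/-- A set `h ⊆ γ` read inside the complement block of `g`. [this work] -/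
def inCoblock (g h : Finset γ) : Finset {a // a ∉ g} := univ.filter fun a => a.1 ∈ h

omit [DecidableEq β] [Fintype β] [Fintype γ] in
/-- Points of a relabeled set, left block. [this work] -/
theorem inl_mem_iff {g : Finset γ} {s : Finset ({a // a ∈ g} ⊕ {a // a ∉ g})} (x : {a // a ∈ g}) :
    (x : γ) ∈ s.map (blockEquiv g).symm.toEmbedding ↔ Sum.inl x ∈ s := by
  rw [mem_map_symm_iff]
  unfold blockEquiv
  rw [Equiv.sumCompl_symm_apply_pos]

omit [DecidableEq β] [Fintype β] [Fintype γ] in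
/-- Points of a relabeled set, right block. [this work] -/
theorem inr_mem_iff {g : Finset γ} {s : Finset ({a // a ∈ g} ⊕ {a // a ∉ g})} (y : {a // a ∉ g}) :
    (y : γ) ∈ s.map (blockEquiv g).symm.toEmbedding ↔ Sum.inr y ∈ s := by
  rw [mem_map_symm_iff]
  unfold blockEquiv
  rw [Equiv.sumCompl_symm_apply_neg]

omit [DecidableEq β] [Fintype β] in
/-- **The relabeled family**: `famMap (blockEquiv g) (twoGen g h) = orProd (upGen univ) (upGen (inCoblock g h))` for `Disjoint g h`. [this work] -/
theorem famMap_twoGen_disjoint {g h : Finset γ} (hgh : Disjoint g h) :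
    famMap (blockEquiv g) (twoGen g h) = orProd (upGen (univ : Finset {a // a ∈ g})) (upGen (inCoblock g h)) := by
  ext s
  rw [mem_famMap, mem_orProd]
  simp only [twoGen, upGen, inCoblock, mem_filter, mem_univ, true_and]
  have hL : g ⊆ s.map (blockEquiv g).symm.toEmbedding ↔ univ ⊆ s.toLeft := by
    constructor
    · intro hsub x _
      rw [mem_toLeft]
      exact (inl_mem_iff x).1 (hsub x.2)
    · intro hsub a ha
      have := hsub (mem_univ ⟨a, ha⟩)
      rw [mem_toLeft] at this
      exact (inl_mem_iff ⟨a, ha⟩).2 this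
  have hR : h ⊆ s.map (blockEquiv g).symm.toEmbedding ↔ (univ.filter fun a : {a // a ∉ g} => a.1 ∈ h) ⊆ s.toRight := by
    constructor
    · intro hsub y hy
      rw [mem_filter] at hy
      rw [mem_toRight]
      exact (inr_mem_iff y).1 (hsub hy.2)
    · intro hsub a ha
      have hag : a ∉ g := fun hag => disjoint_left.1 hgh hag ha
      have := hsub (mem_filter.2 ⟨mem_univ (⟨a, hag⟩ : {a // a ∉ g}), ha⟩)
      rw [mem_toRight] at this
      exact (inr_mem_iff ⟨a, hag⟩).2 this
  rw [hL, hR]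

omit [DecidableEq β] [Fintype β] in
/-- **The shell of `↑g ∪ ↑h` (`g, h` disjoint and nonempty) is a Kleitman shell.** [this work] -/
theorem klShell_twoGen_disjoint {g h : Finset γ} (hgh : Disjoint g h) (hg : g.Nonempty) (hh : h.Nonempty) :
    KlShell (twoGen g h ∪ refl (twoGen g h)) := by
  -- transport the OR-product shell back along `(blockEquiv g)⁻¹`
  have hu : (univ : Finset {a // a ∈ g}).Nonempty := by
    obtain ⟨a, ha⟩ := hg
    exact ⟨⟨a, ha⟩, mem_univ _⟩
  have hh' : (inCoblock g h).Nonempty := by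
    obtain ⟨a, ha⟩ := hh
    have hag : a ∉ g := fun hag => disjoint_left.1 hgh hag ha
    exact ⟨⟨a, hag⟩, mem_filter.2 ⟨mem_univ _, ha⟩⟩
  have hsh := klShell_orProd (klShell_upGen hu) (klShell_upGen hh')
  rw [← famMap_twoGen_disjoint hgh, refl_famMap, ← famMap_union] at hsh
  have := klShell_famMap (blockEquiv g).symm hsh
  rwa [famMap_symm_famMap] at this

/-- **`TriWIneq` for two disjoint generators**: `Disjoint g h`, `g ≠ ∅ ≠ h` ⟹ `0 ≤ triW (twoGen g h) F G` for EVERY index cube `Finset β` and all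
monotone families `F, G` of up-sets of `Finset γ` (coordinates outside `g ∪ h` are free). [this work] -/
theorem triW_nonneg_twoGen_disjoint {g h : Finset γ} (hgh : Disjoint g h) (hg : g.Nonempty) (hh : h.Nonempty)
    (F G : Finset β → Finset (Finset γ))
    (hF : ∀ x, IsUpperSet (F x : Set (Finset γ))) (hG : ∀ x, IsUpperSet (G x : Set (Finset γ)))
    (hFm : Monotone F) (hGm : Monotone G) :
    0 ≤ triW (twoGen g h) F G :=
  triW_nonneg_of_shell (isUpperSet_twoGen g h) (klShell_twoGen_disjoint hgh hg hh) F G hF hG hFm hGm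

end FiveUpSet

end Summit.CriticalPhenomena.PercolationContinuityZ3.Theorems
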